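import Literature.Probability.Percolation.TriBoxCrossingLowerBound
import Literature.Probability.Percolation.BoxCrossingUpperBound
import Literature.Probability.Percolation.TriLatticeSegments
import Literature.Topology.PlaneTopology.CrosscutProofs
import HarnessLib

/-!
# The closed cross-cut and the RSW upper bound for conformal-rectangle crossings on `δ𝕋`

Topic: Probability / Percolation. Triangular twin of `BoxCrossingUpperBound.lean`: the "bounded
away from `1`" half of the RSW non-degeneracy of conformal-rectangle crossings (Grimmett,
*Probability on Graphs*, 2nd ed. (2018), §5.7, PDF p. 176, for site percolation on `𝕋`: "`P_δ(ac ↔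
bx in D)` is uniformly bounded away from `0` and `1` as `δ → 0`"; Bollobás–Riordan,
*Percolation* (2006), Ch. 7 §2 for duality on the triangular lattice: the matching lattice of `𝕋`
is `𝕋` itself, an open path cannot cross a closed one), for H21's discretisation `triCrossing`,
i.e. the discharge `triCrossingProb_upperBound_holds` of the named fact
`triCrossingProb_upperBound` (`TriBoxCrossingProofs.lean`).

**Traces of `𝕋`-walks** (`triEdgeSeg`, `triWalkTrace`): the closed mesh edges of a walk at mesh
`δ`. Two mesh edges of `δ𝕋` meet only at a common endpoint unless they coincide
(`triEdgeSeg_inter`, from `unitEdge_inter` of `TriLatticeSegments.lean`), so the trace of a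
`𝕋`-*path* is a simple arc (`isSimpleArc_triWalkTrace`) and the trace of a walk through sites of
`χ` misses every mesh edge with both endpoints outside `χ` (`disjoint_segment_triWalkTrace`) —
this replaces the primal/dual planar lattice of the `ℤ²` bond version.

**The closed cross-cut** (`exists_closed_crosscut`): for a configuration `χ` in the chain events
of the *conjugate* rectangle (arcs `1`, `3`; circuits and long crossings of `χ`-sites from near
`b' ∈ arc 1°` to near `d' ∈ arc 3°`, big circuits about `b'`, `d'`), the skeleton of
`TriBoxCrossingLowerBound.lean` (`exists_triChain_skeleton`) is turned into a cross-cut `Λ` of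
`Ω` (a simple arc in `Ω̄` meeting `∂Ω` exactly in its end-points `boundary s`, `s ∈ (mark 1,
mark 2)`, and `boundary t`, `t ∈ (mark 3, mark 0 + 1)`): exit sub-segment at `b'` + trace of a
`𝕋`-path of `χ`-sites whose mesh edges lie in `Ω` + exit sub-segment at `d'` (first exits
`exists_closed_exit`, `exists_first_exit`; gluing `IsSimpleArc.union`).

**Blocking** (`not_mem_triCrossing_compl_of_crosscut`): by Newman's cross-cut theorem
(`Newman1939_crosscut_holds`, `JordanDomain.inter_nonempty_of_crosscut`) an open crossing of
`Ω_δ` in the complementary configuration `χᶜ` from the discrete arc of `arc 0` to that of `arc 2`,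
extended at its ends to `∂Ω`, would meet `Λ` — impossible on the lattice part (colours) and at
the shallow ends (metric bookkeeping, as for `ℤ²`).

**Probability** (`triCrossingProb_upperBound_holds`): the chain events have probability
`≥ c' > 0` uniformly in `δ` (`le_real_triChainEvents`), so does their pull-back under
complementation (`triSitePercolation_half_real_preimage_compl`, colour symmetry at `p = 1/2`),
on which there is no open crossing; hence `P_{1/2}[C_δ] ≤ 1 - c'` for small `δ`, for *every*
conformal rectangle (no bulk property is needed for this half).

Mathlib anchors: `segment`, `Sym2.lift`, `SimpleGraph.Walk` (`bypass`, `rotate`, `mapLe`,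
`edges`), `IsClosed.csInf_mem` (through `exists_first_exit`), `measureReal_union`. Tree anchors:
`unitEdge_inter`, `triGraph_adj_iff_triDir` (`TriLatticeSegments.lean`, `TriDiscShelling.lean`),
`IsSimpleArc` (`.union`, `.subsegment`, `.segment`), `JordanDomain.IsCrosscut`,
`Newman1939_crosscut_holds`, `JordanDomain.inter_nonempty_of_crosscut`, the lattice-free lemmas of
`BoxCrossingUpperBound.lean` (`exists_first_exit`, `exists_prefix_of_not_good`,
`exists_param_of_mem_subsegment`, `subsegment_subset`, `eq_one_of_mem_subsegment`,
`exists_mem_Ioo_of_mem_arc_one/three`, `exists_forall_dist_boundary_lt`, `crosscut_param_bounds`,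
`disjoint_image_Icc_arc_zero/two`, `exists_Ioo_of_infDist_arc_zero/two`), and
`exists_triChain_skeleton`, `exists_exterior_triWalk`, `le_real_triChainEvents`
(`TriBoxCrossingLowerBound.lean`).

## References
* G. Grimmett, *Probability on Graphs*, 2nd ed., CUP (2018), §5.7 p. 176, Ex. 5.6 p. 186.
  [Grimmett2018]
* B. Bollobás, O. Riordan, *Percolation*, CUP (2006), Ch. 7 §2. [BollobasRiordan2006]
* M. H. A. Newman, *Elements of the topology of plane sets of points* (1939), Ch. V §11.
  [Newman1939]
-/

namespace Literature.Probability.Percolation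

open Set Metric MeasureTheory Filter LatticeModels Literature.Topology.PlaneTopology
open scoped _root_.Topology

noncomputable section

/-! ### Traces of `𝕋`-walks at mesh `δ` -/

/-- The closed mesh edge `[δx, δy]` of an unordered pair `{x, y}` of sites. [folklore] -/
def triEdgeSeg (δ : ℝ) : Sym2 (Site 2) → Set ℂ :=
  Sym2.lift ⟨fun x y => segment ℝ (triMeshPoint δ x) (triMeshPoint δ y), fun _ _ => segment_symm ℝ _ _⟩

/-- The mesh edge of `s(x, y)` is the segment `[δx, δy]`. [folklore] -/
@[simp] theorem triEdgeSeg_mk (δ : ℝ) (x y : Site 2) :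
    triEdgeSeg δ s(x, y) = segment ℝ (triMeshPoint δ x) (triMeshPoint δ y) := rfl

/-- Both endpoints lie on the mesh edge. [folklore] -/
theorem triMeshPoint_mem_triEdgeSeg {δ : ℝ} {e : Sym2 (Site 2)} {x : Site 2} (hx : x ∈ e) :
    triMeshPoint δ x ∈ triEdgeSeg δ e := by
  induction e using Sym2.ind with
  | h a b =>
    rcases Sym2.mem_iff.1 hx with rfl | rfl
    · exact left_mem_segment ℝ _ _
    · exact right_mem_segment ℝ _ _

/-- The planar trace at mesh `δ` of a `𝕋`-walk: the union of its closed mesh edges. [folklore] -/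
def triWalkTrace (δ : ℝ) {u v : Site 2} (W : triGraph.Walk u v) : Set ℂ := ⋃ e ∈ W.edges, triEdgeSeg δ e

/-- Membership in the trace. [folklore] -/
theorem mem_triWalkTrace_iff {δ : ℝ} {u v : Site 2} {W : triGraph.Walk u v} {z : ℂ} :
    z ∈ triWalkTrace δ W ↔ ∃ e ∈ W.edges, z ∈ triEdgeSeg δ e := by
  simp only [triWalkTrace, mem_iUnion, exists_prop]

/-- The trace of a trivial walk is empty. [folklore] -/
@[simp] theorem triWalkTrace_nil (δ : ℝ) (u : Site 2) :
    triWalkTrace δ (SimpleGraph.Walk.nil : triGraph.Walk u u) = ∅ := by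
  ext z; simp [mem_triWalkTrace_iff]

/-- The trace of a `cons` walk. [folklore] -/
theorem triWalkTrace_cons {δ : ℝ} {u v w : Site 2} (h : triGraph.Adj u v) (p : triGraph.Walk v w) :
    triWalkTrace δ (SimpleGraph.Walk.cons h p) =
      segment ℝ (triMeshPoint δ u) (triMeshPoint δ v) ∪ triWalkTrace δ p := by
  ext z
  simp only [mem_triWalkTrace_iff, SimpleGraph.Walk.edges_cons, List.mem_cons, exists_eq_or_imp,
    triEdgeSeg_mk, mem_union]

/-- The trace only depends on the edge list: a walk using only edges of another walk has a
smaller trace. [folklore] -/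
theorem triWalkTrace_subset_of_edges_subset {δ : ℝ} {u v u' v' : Site 2} {W : triGraph.Walk u v}
    {W' : triGraph.Walk u' v'} (h : ∀ e ∈ W.edges, e ∈ W'.edges) : triWalkTrace δ W ⊆ triWalkTrace δ W' := by
  intro z hz
  obtain ⟨e, he, hze⟩ := mem_triWalkTrace_iff.1 hz
  exact mem_triWalkTrace_iff.2 ⟨e, h e he, hze⟩

/-- The trace of the reversed walk is the same. [folklore] -/
theorem triWalkTrace_reverse {δ : ℝ} {u v : Site 2} (W : triGraph.Walk u v) :
    triWalkTrace δ W.reverse = triWalkTrace δ W := by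
  ext z; simp only [mem_triWalkTrace_iff, SimpleGraph.Walk.edges_reverse, List.mem_reverse]

/-- Every vertex of a non-trivial walk lies on its trace. [folklore] -/
theorem triMeshPoint_mem_triWalkTrace {δ : ℝ} {u v : Site 2} {W : triGraph.Walk u v} (hn : ¬ W.Nil)
    {x : Site 2} (hx : x ∈ W.support) : triMeshPoint δ x ∈ triWalkTrace δ W := by
  obtain ⟨e, he, hxe⟩ := (SimpleGraph.Walk.mem_support_iff_exists_mem_edges_of_not_nil hn).1 hx
  exact mem_triWalkTrace_iff.2 ⟨e, he, triMeshPoint_mem_triEdgeSeg hxe⟩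

/-- **The trace of a `𝕋`-walk is preconnected** (a polygonal curve). [folklore] -/
theorem isPreconnected_triWalkTrace (δ : ℝ) {u v : Site 2} (W : triGraph.Walk u v) :
    IsPreconnected (triWalkTrace δ W) := by
  induction W with
  | nil => simp [isPreconnected_empty]
  | @cons a b c h p ih =>
    rw [triWalkTrace_cons]
    by_cases hp : p.Nil
    · cases hp
      rw [triWalkTrace_nil, union_empty]
      exact (convex_segment _ _).isPreconnected
    · exact IsPreconnected.union (triMeshPoint δ b) (right_mem_segment ℝ _ _)
        (triMeshPoint_mem_triWalkTrace hp p.start_mem_support) (convex_segment _ _).isPreconnected ih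

/-- The trace of a walk lies in every convex set containing its vertices. [folklore] -/
theorem triWalkTrace_subset_of_convex {δ : ℝ} {u v : Site 2} {W : triGraph.Walk u v} {C : Set ℂ}
    (hC : Convex ℝ C) (hs : ∀ x ∈ W.support, triMeshPoint δ x ∈ C) : triWalkTrace δ W ⊆ C := by
  intro z hz
  obtain ⟨e, he, hze⟩ := mem_triWalkTrace_iff.1 hz
  revert hze
  induction e using Sym2.ind with
  | h x y =>
    intro hze
    exact hC.segment_subset (hs x (W.fst_mem_support_of_mem_edges he))
      (hs y (W.snd_mem_support_of_mem_edges he)) hze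

/-- If every mesh edge of the walk lies in `Ω`, so does its trace. [folklore] -/
theorem triWalkTrace_subset_of_edges {δ : ℝ} {u v : Site 2} {W : triGraph.Walk u v} {Ω : Set ℂ}
    (h : ∀ e ∈ W.edges, triEdgeSeg δ e ⊆ Ω) : triWalkTrace δ W ⊆ Ω := by
  intro z hz
  obtain ⟨e, he, hze⟩ := mem_triWalkTrace_iff.1 hz
  exact h e he hze

/-! ### Two mesh edges of `δ𝕋` meet only at a common endpoint -/

/-- Mesh points are scaled embedded points, and mesh edges are scaled unit edges. [folklore] -/
theorem segment_triMeshPoint_eq_image (δ : ℝ) (x y : Site 2) :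
    segment ℝ (triMeshPoint δ x) (triMeshPoint δ y) =
      (fun z : ℂ => (δ : ℂ) * z) '' segment ℝ (triEmbed x) (triEmbed y) := by
  rw [segment_eq_image', segment_eq_image', image_image]
  refine congrArg (fun f : ℝ → ℂ => f '' Icc (0 : ℝ) 1) (funext fun θ => ?_)
  simp only [triMeshPoint, Complex.real_smul]
  ring

/-- `triMeshPoint δ` is injective for `δ ≠ 0`. [folklore] -/
theorem triMeshPoint_injective {δ : ℝ} (hδ : δ ≠ 0) : Function.Injective (triMeshPoint δ) := by
  intro x y h
  have h' : (δ : ℂ) * triEmbed x = (δ : ℂ) * triEmbed y := h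
  exact triEmbed_injective (mul_left_cancel₀ (by exact_mod_cast hδ) h')

/-- **Two mesh edges of `δ𝕋` meet only at a common endpoint, unless they coincide**: a point of
both `[δx, δy]` and `[δu, δv]` (`x ∼ y`, `u ∼ v` in `𝕋`, `δ ≠ 0`) is an endpoint of each, or the
two edges are the same. (From `unitEdge_inter`: planarity of the equilateral embedding.)
[folklore] -/
theorem triEdgeSeg_inter {δ : ℝ} (hδ : δ ≠ 0) {x y u v : Site 2} (hxy : triGraph.Adj x y)
    (huv : triGraph.Adj u v) {z : ℂ} (hz : z ∈ segment ℝ (triMeshPoint δ x) (triMeshPoint δ y))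
    (hz' : z ∈ segment ℝ (triMeshPoint δ u) (triMeshPoint δ v)) :
    ((z = triMeshPoint δ x ∨ z = triMeshPoint δ y) ∧ (z = triMeshPoint δ u ∨ z = triMeshPoint δ v)) ∨
      s(x, y) = s(u, v) := by
  obtain ⟨k, rfl⟩ := (triGraph_adj_iff_triDir x y).1 hxy
  obtain ⟨l, rfl⟩ := (triGraph_adj_iff_triDir u v).1 huv
  rw [segment_triMeshPoint_eq_image] at hz hz'
  obtain ⟨q, hq, rfl⟩ := hz
  obtain ⟨q', hq', hqq'⟩ := hz'
  have hδ' : (δ : ℂ) ≠ 0 := by exact_mod_cast hδ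
  obtain rfl : q' = q := mul_left_cancel₀ hδ' hqq'
  rcases unitEdge_inter hq hq' with ⟨h1, h2⟩ | ⟨h1, h2⟩ | ⟨h1, h2⟩
  · left
    refine ⟨?_, ?_⟩
    · rcases h1 with rfl | rfl
      · exact Or.inl rfl
      · exact Or.inr rfl
    · rcases h2 with rfl | rfl
      · exact Or.inl rfl
      · exact Or.inr rfl
  · right; rw [h2, h1]
  · right; rw [h2, h1, Sym2.eq_swap]

/-! ### The trace of a `𝕋`-path is a simple arc -/

/-- Adjacent sites have distinct mesh points (`δ ≠ 0`). [folklore] -/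
theorem triMeshPoint_ne_of_adj {δ : ℝ} (hδ : δ ≠ 0) {x y : Site 2} (h : triGraph.Adj x y) :
    triMeshPoint δ x ≠ triMeshPoint δ y := fun h' => h.ne (triMeshPoint_injective hδ h')

/-- **The trace of a `𝕋`-path is a simple arc** between the mesh points of its endpoints: the
segments are glued one at a time, consecutive pieces meeting only at the common vertex because a
path does not revisit vertices and distinct mesh edges meet only at common endpoints. [folklore] -/
theorem isSimpleArc_triWalkTrace {δ : ℝ} (hδ : δ ≠ 0) {u v : Site 2} {W : triGraph.Walk u v}
    (hW : W.IsPath) (hn : ¬ W.Nil) :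
    IsSimpleArc (triWalkTrace δ W) (triMeshPoint δ u) (triMeshPoint δ v) := by
  induction W with
  | nil => exact absurd SimpleGraph.Walk.Nil.nil hn
  | @cons a b c h p ih =>
    rw [SimpleGraph.Walk.cons_isPath_iff] at hW
    obtain ⟨hp, ha⟩ := hW
    have hab : triMeshPoint δ a ≠ triMeshPoint δ b := triMeshPoint_ne_of_adj hδ h
    rw [triWalkTrace_cons]
    by_cases hpn : p.Nil
    · cases hpn
      rw [triWalkTrace_nil, union_empty]
      exact IsSimpleArc.segment hab
    · refine (IsSimpleArc.segment hab).union (ih hp hpn) ?_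
      rintro z ⟨hz, hz'⟩
      obtain ⟨e', he', hze'⟩ := mem_triWalkTrace_iff.1 hz'
      revert he' hze'
      induction e' using Sym2.ind with
      | h x y =>
        intro he' hze'
        have hxy : triGraph.Adj x y := p.adj_of_mem_edges he'
        rw [triEdgeSeg_mk] at hze'
        rcases triEdgeSeg_inter hδ h hxy hz hze' with ⟨h1, h2⟩ | heq
        · rcases h1 with rfl | rfl
          · -- `z = δa`, but `a` is not a vertex of `p`
            exfalso
            rcases h2 with h2 | h2
            · exact ha (triMeshPoint_injective hδ h2 ▸ p.fst_mem_support_of_mem_edges he')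
            · exact ha (triMeshPoint_injective hδ h2 ▸ p.snd_mem_support_of_mem_edges he')
          · rfl
        · exfalso
          have : a ∈ s(x, y) := by rw [← heq]; exact Sym2.mem_mk_left a b
          rcases Sym2.mem_iff.1 this with rfl | rfl
          · exact ha (p.fst_mem_support_of_mem_edges he')
          · exact ha (p.snd_mem_support_of_mem_edges he')

/-! ### Monochromatic walks and mesh edges of the other colour do not meet -/

/-- **A mesh edge with both endpoints outside `χ` misses the trace of a walk through sites of
`χ`**: a common point would be a common endpoint of two mesh edges with endpoints of different
colours, or the two edges would coincide (Bollobás–Riordan 2006, Ch. 7 §2: on the triangular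
lattice an open path and a closed path cannot cross). [cite: BollobasRiordan2006, Ch. 7 §2] -/
theorem disjoint_segment_triWalkTrace {δ : ℝ} (hδ : δ ≠ 0) {χ : Set (Site 2)} {a b : Site 2}
    {W : triGraph.Walk a b} (hW : ∀ z ∈ W.support, z ∈ χ) {p q : Site 2} (hpq : triGraph.Adj p q)
    (hp : p ∉ χ) (hq : q ∉ χ) :
    Disjoint (segment ℝ (triMeshPoint δ p) (triMeshPoint δ q)) (triWalkTrace δ W) := by
  refine disjoint_left.2 fun z hz hz' => ?_
  obtain ⟨e, he, hze⟩ := mem_triWalkTrace_iff.1 hz'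
  revert he hze
  induction e using Sym2.ind with
  | h x y =>
    intro he hze
    have hxy : triGraph.Adj x y := W.adj_of_mem_edges he
    have hx : x ∈ χ := hW x (W.fst_mem_support_of_mem_edges he)
    have hy : y ∈ χ := hW y (W.snd_mem_support_of_mem_edges he)
    rw [triEdgeSeg_mk] at hze
    rcases triEdgeSeg_inter hδ hpq hxy hz hze with ⟨h1, h2⟩ | heq
    · rcases h1 with rfl | rfl <;> rcases h2 with h2 | h2
      · exact hp (triMeshPoint_injective hδ h2 ▸ hx)
      · exact hp (triMeshPoint_injective hδ h2 ▸ hy)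
      · exact hq (triMeshPoint_injective hδ h2 ▸ hx)
      · exact hq (triMeshPoint_injective hδ h2 ▸ hy)
    · have : p ∈ s(x, y) := by rw [← heq]; exact Sym2.mem_mk_left p q
      rcases Sym2.mem_iff.1 this with rfl | rfl
      · exact hp hx
      · exact hp hy

/-! ### Sub-segments of mesh edges -/

/-- Points of the initial piece `[a, f]`, `f = a + t (b - a)`, other than `f` lie in `Ω` when
all earlier parameters do (they come before the first exit). [folklore] -/
theorem mem_of_mem_subsegment_of_ne {Ω : Set ℂ} {a b : ℂ} {t : ℝ} (ht0 : 0 < t) {f : ℂ}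
    (hf : f = a + t • (b - a)) (hbefore : ∀ s : ℝ, 0 ≤ s → s < t → a + s • (b - a) ∈ Ω)
    {z : ℂ} (hz : z ∈ segment ℝ a f) (hzf : z ≠ f) : z ∈ Ω := by
  rw [hf] at hz
  obtain ⟨θ, hθ, rfl⟩ := exists_param_of_mem_subsegment hz
  refine hbefore _ (mul_nonneg hθ.1 ht0.le) ?_
  rcases hθ.2.eq_or_lt with rfl | hθ1
  · exact absurd (by rw [hf, one_mul]) hzf
  · nlinarith

/-- Points of an initial piece `[δx, f]` of the mesh edge `[δx, δy]` are within `|δ|` of `δx`.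
[folklore] -/
theorem dist_le_of_mem_subsegment_triMeshPoint {δ : ℝ} {x y : Site 2} (hxy : triGraph.Adj x y)
    {f : ℂ} (hf : f ∈ segment ℝ (triMeshPoint δ x) (triMeshPoint δ y)) {z : ℂ}
    (hz : z ∈ segment ℝ (triMeshPoint δ x) f) : dist z (triMeshPoint δ x) ≤ |δ| := by
  have hsub' : segment ℝ (triMeshPoint δ x) f ⊆ closedBall (triMeshPoint δ x) |δ| :=
    (convex_closedBall _ _).segment_subset (mem_closedBall_self (abs_nonneg δ))
      (segment_triMeshPoint_subset_closedBall hxy hf)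
  exact mem_closedBall.1 (hsub' hz)

/-- The point `a + t (b - a)`, `t ∈ [0, 1]`, lies on `[a, b]`. [folklore] -/
theorem add_smul_sub_mem_segment {a b : ℂ} {t : ℝ} (ht0 : 0 ≤ t) (ht1 : t ≤ 1) :
    a + t • (b - a) ∈ segment ℝ a b := by
  rw [segment_eq_image']
  exact ⟨t, ⟨ht0, ht1⟩, rfl⟩

/-- **An exit sub-segment meets a good trace only at its start.** If `f = δx + t (δy - δx)`
(`0 < t ≤ 1`) is a point outside `Ω` on the mesh edge `[δx, δy]`, then `[δx, f]` meets the trace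
of any `𝕋`-walk all of whose mesh edges lie in `Ω` at most in the point `δx`. [folklore] -/
theorem segment_inter_triWalkTrace_subset {δ : ℝ} (hδ : 0 < δ) {Ω : Set ℂ} {x y : Site 2}
    (hxy : triGraph.Adj x y) {t : ℝ} (ht0 : 0 < t) (ht1 : t ≤ 1) {f : ℂ}
    (hf : f = triMeshPoint δ x + t • (triMeshPoint δ y - triMeshPoint δ x)) (hfΩ : f ∉ Ω)
    {a b : Site 2} {Q : triGraph.Walk a b} (hgood : ∀ e ∈ Q.edges, triEdgeSeg δ e ⊆ Ω) :
    segment ℝ (triMeshPoint δ x) f ∩ triWalkTrace δ Q ⊆ {triMeshPoint δ x} := by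
  rintro z ⟨hz, hz'⟩
  rw [mem_singleton_iff]
  have hsub : segment ℝ (triMeshPoint δ x) f ⊆ segment ℝ (triMeshPoint δ x) (triMeshPoint δ y) := by
    rw [hf]; exact subsegment_subset ht0.le ht1
  obtain ⟨e', he', hze'⟩ := mem_triWalkTrace_iff.1 hz'
  have hzΩ : z ∈ Ω := hgood e' he' hze'
  revert he' hze'
  induction e' using Sym2.ind with
  | h u v =>
    intro he' hze'
    have huv : triGraph.Adj u v := Q.adj_of_mem_edges he'
    rw [triEdgeSeg_mk] at hze'
    rcases triEdgeSeg_inter hδ.ne' hxy huv (hsub hz) hze' with ⟨h1, -⟩ | heq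
    · rcases h1 with rfl | rfl
      · rfl
      · -- `z = δy` on `[δx, f]` forces `t = 1`, `f = δy = z ∈ Ω`: contradiction
        exfalso
        have ht : t = 1 := eq_one_of_mem_subsegment (triMeshPoint_ne_of_adj hδ.ne' hxy) ht0 ht1 (hf ▸ hz)
        rw [ht, one_smul, add_sub_cancel] at hf
        exact hfΩ (hf ▸ hzΩ)
    · -- the same edge: then `f ∈ [δx, δy] ⊆ Ω`
      exfalso
      refine hfΩ (hgood _ he' ?_)
      rw [← heq, triEdgeSeg_mk, hf]
      exact add_smul_sub_mem_segment ht0.le ht1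

/-! ### Exit of the anchoring circuit near a boundary point -/

/-- **Exit of the anchoring circuit.** Let `w` be a closed `𝕋`-walk meeting every `𝕋`-walk across
its annulus `5L ≤ |· - aS|_𝕋 ≤ 7L`, let some `𝕋`-walk with all mesh points outside `closure Ω`
cross the annulus, and let `s` be a vertex of `w` with `δ s ∈ Ω`. Following `w` from `s` one meets
a first `𝕋`-edge `{x, y}` of `w` whose mesh edge leaves `Ω`, at a first exit point `f` on the
frontier; the initial sub-walk `W₁` from `s` to `x` has all its mesh edges inside `Ω`. [folklore] -/
theorem exists_closed_exit {Ω : Set ℂ} (hΩ : IsOpen Ω) {δ : ℝ} {L : ℕ} {aS : Site 2}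
    {cw : Site 2} {w : triGraph.Walk cw cw}
    (hsep : ∀ (x y : Site 2) (q : triGraph.Walk x y), triNorm (x - aS) < 5 * L →
      (7 * L : ℤ) < triNorm (y - aS) → ∃ z ∈ q.support, z ∈ w.support)
    {xe ye : Site 2} (qe : triGraph.Walk xe ye) (hxe : triNorm (xe - aS) < 5 * L)
    (hye : (7 * L : ℤ) < triNorm (ye - aS)) (hqe : ∀ z ∈ qe.support, triMeshPoint δ z ∉ closure Ω)
    {s : Site 2} (hs : s ∈ w.support) (hsΩ : triMeshPoint δ s ∈ Ω) :
    ∃ (x y : Site 2) (W₁ : triGraph.Walk s x) (t : ℝ) (f : ℂ),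
      triGraph.Adj x y ∧ s(x, y) ∈ w.edges ∧
      (∀ z ∈ W₁.support, z ∈ w.support) ∧ (∀ e ∈ W₁.edges, triEdgeSeg δ e ⊆ Ω) ∧
      ¬ triEdgeSeg δ s(x, y) ⊆ Ω ∧ y ∈ w.support ∧
      0 < t ∧ t ≤ 1 ∧ f = triMeshPoint δ x + t • (triMeshPoint δ y - triMeshPoint δ x) ∧
      f ∈ frontier Ω ∧ f ∉ Ω ∧
      ∀ s' : ℝ, 0 ≤ s' → s' < t → triMeshPoint δ x + s' • (triMeshPoint δ y - triMeshPoint δ x) ∈ Ω := by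
  classical
  -- an exterior vertex `u` of the circuit
  obtain ⟨u, huq, huw⟩ := hsep xe ye qe hxe hye
  have huΩ : triMeshPoint δ u ∉ Ω := fun h => hqe u huq (subset_closure h)
  have hus : u ≠ s := by rintro rfl; exact huΩ hsΩ
  set W := w.rotate s hs with hW
  have huW : u ∈ W.support := (w.mem_support_rotate_iff s hs).2 huw
  have hWn : ¬ W.Nil := by
    intro hn
    rw [SimpleGraph.Walk.nil_iff_support_eq] at hn
    rw [hn, List.mem_singleton] at huW
    exact hus huW
  -- some edge of `W` is bad (the one through `u`)
  set good : Sym2 (Site 2) → Prop := fun e => triEdgeSeg δ e ⊆ Ω with hgood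
  obtain ⟨e₀, he₀, hue₀⟩ := (SimpleGraph.Walk.mem_support_iff_exists_mem_edges_of_not_nil hWn).1 huW
  have hbad₀ : ¬ good e₀ := fun hg => huΩ (hg (triMeshPoint_mem_triEdgeSeg hue₀))
  have hedges : ∀ e, e ∈ W.edges ↔ e ∈ w.edges := fun e => (w.rotate_edges s hs).mem_iff
  obtain ⟨x, y, W₁, hxy, hmem, hbad, hsub, hgoodW₁, hsupp, hyW⟩ :=
    exists_prefix_of_not_good good W ⟨e₀, he₀, hbad₀⟩
  have hsuppw : ∀ z ∈ W₁.support, z ∈ w.support := fun z hz =>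
    (w.mem_support_rotate_iff s hs).1 (hsupp z hz)
  have hyw : y ∈ w.support := (w.mem_support_rotate_iff s hs).1 hyW
  -- the start `x` of the bad edge is inside `Ω`
  have hxΩ : triMeshPoint δ x ∈ Ω := by
    by_cases hn : W₁.Nil
    · rw [← hn.eq]; exact hsΩ
    · obtain ⟨e, he, hxe⟩ :=
        (SimpleGraph.Walk.mem_support_iff_exists_mem_edges_of_not_nil hn).1 W₁.end_mem_support
      exact hgoodW₁ e he (triMeshPoint_mem_triEdgeSeg hxe)
  have hseg : ¬ segment ℝ (triMeshPoint δ x) (triMeshPoint δ y) ⊆ Ω := by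
    rwa [← triEdgeSeg_mk]
  obtain ⟨t, ht0, ht1, hfr, hfΩ, hbefore⟩ := exists_first_exit hΩ hxΩ hseg
  exact ⟨x, y, W₁, t, _, hxy, (hedges _).1 hmem, hsuppw, hgoodW₁, hbad, hyw, ht0, ht1, rfl, hfr,
    hfΩ, hbefore⟩

/-! ### The closed cross-cut -/

/-- **The closed cross-cut** (deterministic heart of the RSW upper bound; Grimmett 2018, §5.7 /
Ex. 5.6; Bollobás–Riordan 2006, Ch. 7 §2 for the triangular lattice; triangular twin of
`exists_dual_crosscut`). In a conformal rectangle `R`, fix boundary points `b'` inside `arc 1` and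
`d'` inside `arc 3` with isolating radius `r` and chain points `c 0, …, c N` of `Ω` from near `b'`
to near `d'` (as in `exists_chainData`), a mesh `δ ≤ w/1000` with scales `m δ ≤ w/20 < (m+1) δ`,
`L δ ≤ r/20 < (L+1) δ`, roundings of the centres and of `b'`, `d'`, and exterior `𝕋`-walks near
`b'`, `d'`. If a site configuration `χ` has open circuits of scale `m` about the rounded centres,
open long-way crossings of the long parallelograms between them, and open circuits of scale `L`
about the roundings of `b'` and `d'`, then there is a cross-cut `Λ` of `Ω` from a point
`boundary s` strictly inside `arc 1` to a point `boundary t` strictly inside `arc 3`, every point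
of which lies on a closed mesh edge `[δp, δq]` with `p ∼ q` both in `χ`, and which stays either
within `7 L δ + 3 δ` of `b'` or of `d'`, or at depth `≥ w/4` inside `Ω`.
[cite: Grimmett2018, §5.7 p. 176 and Exercise 5.6 p. 186] -/
theorem exists_closed_crosscut (R : RandomPlanarGeometry.ConformalRectangle)
    {b' d' : ℂ} {r w : ℝ} {N : ℕ} {c : ℕ → ℂ} (hwr : w ≤ r / 40)
    (hrb : ∀ z ∈ frontier R.carrier, dist z b' < r → z ∈ R.arc 1)
    (hrb' : ∀ j, j ≠ 1 → ∀ z ∈ R.arc j, r ≤ dist z b')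
    (hrd : ∀ z ∈ frontier R.carrier, dist z d' < r → z ∈ R.arc 3)
    (hrd' : ∀ j, j ≠ 3 → ∀ z ∈ R.arc j, r ≤ dist z d')
    (hbd : 10 * r ≤ dist b' d') (hc0 : dist (c 0) b' < r / 40) (hcN : dist (c N) d' < r / 40)
    (hstep : ∀ k < N, dist (c k) (c (k + 1)) ≤ w / 100)
    (hball : ∀ k ≤ N, closedBall (c k) w ⊆ R.carrier)
    {δ : ℝ} (hδ : 0 < δ) (hδw : δ ≤ w / 1000)
    {m : ℕ} (hm1 : 1 ≤ m) (hmw : (m : ℝ) * δ ≤ w / 20) (hmw' : w / 20 < ((m : ℝ) + 1) * δ)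
    {L : ℕ} (hLr : (L : ℝ) * δ ≤ r / 20) (hLr' : r / 20 < ((L : ℝ) + 1) * δ)
    {v : ℕ → Site 2} (hv : ∀ k ≤ N, dist (c k) (triMeshPoint δ (v k)) ≤ 7 / 10 * δ)
    {bS dS : Site 2} (hbS : dist b' (triMeshPoint δ bS) ≤ 7 / 10 * δ)
    (hdS : dist d' (triMeshPoint δ dS) ≤ 7 / 10 * δ)
    {xb yb : Site 2} (qb : triGraph.Walk xb yb) (hxb : dist (triMeshPoint δ xb) b' < r / 100)
    (hyb : r < dist (triMeshPoint δ yb) b')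
    (hqb : ∀ z ∈ qb.support, triMeshPoint δ z ∉ closure R.carrier)
    {xd yd : Site 2} (qd : triGraph.Walk xd yd) (hxd : dist (triMeshPoint δ xd) d' < r / 100)
    (hyd : r < dist (triMeshPoint δ yd) d')
    (hqd : ∀ z ∈ qd.support, triMeshPoint δ z ∉ closure R.carrier)
    {χ : SiteConfig (Site 2)}
    (hO : ∀ k ≤ N, χ ∈ triCircuitAt true (v k) m)
    (hX : ∀ k < N, χ ∈ SiteConfig.relabel (triShiftIso (-triChainCorner m (v k))).toEquiv ⁻¹'
      triTBCrossing m (18 * m))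
    (hOb : χ ∈ triCircuitAt true bS L) (hOd : χ ∈ triCircuitAt true dS L) :
    ∃ (Λ : Set ℂ) (s t : ℝ), s ∈ Ioo (R.mark 1) (R.mark 2) ∧ t ∈ Ioo (R.mark 3) (R.mark 0 + 1) ∧
      R.IsCrosscut Λ (R.boundary s) (R.boundary t) ∧
      (∀ z ∈ Λ, ∃ p q : Site 2, triGraph.Adj p q ∧ p ∈ χ ∧ q ∈ χ ∧
        z ∈ segment ℝ (triMeshPoint δ p) (triMeshPoint δ q)) ∧
      (∀ z ∈ Λ, dist z b' ≤ 7 * L * δ + 3 * δ ∨ dist z d' ≤ 7 * L * δ + 3 * δ ∨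
        ball z (w / 4) ⊆ R.carrier) := by
  classical
  have hw0 : 0 < w := by linarith
  have hr0 : 0 < r := by linarith
  have hδr : δ ≤ r / 1000 := by linarith
  have hδabs : |δ| = δ := abs_of_pos hδ
  have hLδ : 7 * (L : ℝ) * δ ≤ 7 * r / 20 := by nlinarith
  -- the skeleton
  obtain ⟨xB, wB, xD, wD, sb, sd, hwB, hsepB, hwD, hsepD, hsbw, hsdw, hPac⟩ :=
    exists_triChain_skeleton hwr hbd hc0 hcN hstep hδ hδw hm1 hmw hmw' hLr hLr' hv hbS hdS hO hX hOb hOd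
  have hχB : ∀ z ∈ wB.support, z ∈ χ := fun z hz => by simpa using (hwB z hz).1
  have hχD : ∀ z ∈ wD.support, z ∈ χ := fun z hz => by simpa using (hwD z hz).1
  -- the tube path, as a walk with good and deep edges
  obtain ⟨Pth, hPth⟩ := hPac.exists_walk
  have hPthχ : ∀ z ∈ Pth.support, z ∈ χ := fun z hz => by simpa using (hPth z hz).1
  have hPth_ball : ∀ e ∈ Pth.edges, ∃ k ≤ N, triEdgeSeg δ e ⊆ closedBall (c k) (w / 2 + 17 / 10 * δ) := by
    intro e he
    revert he
    induction e using Sym2.ind with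
    | h a b =>
      intro he
      obtain ⟨k, hk, hseg⟩ := segment_subset_closedBall_of_mem_triTube hδ hmw hv
        (hPth a (Pth.fst_mem_support_of_mem_edges he)).2 (Pth.adj_of_mem_edges he)
      exact ⟨k, hk, by rw [triEdgeSeg_mk]; exact hseg⟩
  have hPth_good : ∀ e ∈ Pth.edges, triEdgeSeg δ e ⊆ R.carrier := by
    intro e he
    obtain ⟨k, hk, hseg⟩ := hPth_ball e he
    exact hseg.trans ((closedBall_subset_closedBall (by linarith)).trans (hball k hk))
  have hPth_deep : ∀ e ∈ Pth.edges, ∀ z ∈ triEdgeSeg δ e, ball z (w / 4) ⊆ R.carrier := by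
    intro e he z hz y hy
    obtain ⟨k, hk, hseg⟩ := hPth_ball e he
    have hzk := mem_closedBall.1 (hseg hz)
    refine hball k hk (mem_closedBall.2 ?_)
    rw [mem_ball] at hy
    linarith [dist_triangle y z (c k)]
  -- `δ sb`, `δ sd` are in `Ω`
  have hsbΩ : triMeshPoint δ sb ∈ R.carrier := by
    obtain ⟨k, hk, hd⟩ := exists_dist_le_of_mem_triTube hδ hmw hv hPac.left_mem.2
    exact hball k hk (mem_closedBall.2 (by linarith))
  have hsdΩ : triMeshPoint δ sd ∈ R.carrier := by
    obtain ⟨k, hk, hd⟩ := exists_dist_le_of_mem_triTube hδ hmw hv hPac.right_mem.2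
    exact hball k hk (mem_closedBall.2 (by linarith))
  -- the exterior walks in `triNorm` terms
  have hxb' : triNorm (xb - bS) < 5 * L := by
    refine triNorm_lt_of_dist_triMeshPoint_lt hδ (lt_inner_radius hδ hLr' hδr ?_)
    linarith [dist_triangle (triMeshPoint δ xb) b' (triMeshPoint δ bS)]
  have hyb' : (7 * L : ℤ) < triNorm (yb - bS) := by
    refine lt_triNorm_of_lt_dist_triMeshPoint hδ (outer_radius_lt hLr ?_)
    have := dist_triangle (triMeshPoint δ yb) (triMeshPoint δ bS) b'
    rw [dist_comm (triMeshPoint δ bS) b'] at this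
    linarith
  have hxd' : triNorm (xd - dS) < 5 * L := by
    refine triNorm_lt_of_dist_triMeshPoint_lt hδ (lt_inner_radius hδ hLr' hδr ?_)
    linarith [dist_triangle (triMeshPoint δ xd) d' (triMeshPoint δ dS)]
  have hyd' : (7 * L : ℤ) < triNorm (yd - dS) := by
    refine lt_triNorm_of_lt_dist_triMeshPoint hδ (outer_radius_lt hLr ?_)
    have := dist_triangle (triMeshPoint δ yd) (triMeshPoint δ dS) d'
    rw [dist_comm (triMeshPoint δ dS) d'] at this
    linarith
  -- the two exits
  obtain ⟨pb, pb', W₁b, tb, fb, hpbb, -, hW₁bs, hW₁bg, -, hpb'w, htb0, htb1, hfb, hfbfr, hfbΩ,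
      hbeforeb⟩ := exists_closed_exit R.isOpen hsepB qb hxb' hyb' hqb hsbw hsbΩ
  obtain ⟨pd, pd', W₁d, td, fd, hpdd, -, hW₁ds, hW₁dg, -, hpd'w, htd0, htd1, hfd, hfdfr, hfdΩ,
      hbefored⟩ := exists_closed_exit R.isOpen hsepD qd hxd' hyd' hqd hsdw hsdΩ
  -- distances to `b'`, `d'` of circuit vertices
  have hnearB : ∀ z ∈ wB.support, dist (triMeshPoint δ z) b' ≤ 7 * L * δ + 7 / 10 * δ := by
    intro z hz
    have h1 : dist (triMeshPoint δ z) (triMeshPoint δ bS) ≤ (7 * L : ℤ) * δ :=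
      dist_triMeshPoint_le_of_triNorm_le hδ.le (hwB z hz).2.2
    push_cast at h1
    have h2 := hbS
    rw [dist_comm] at h2
    linarith [dist_triangle (triMeshPoint δ z) (triMeshPoint δ bS) b']
  have hnearD : ∀ z ∈ wD.support, dist (triMeshPoint δ z) d' ≤ 7 * L * δ + 7 / 10 * δ := by
    intro z hz
    have h1 : dist (triMeshPoint δ z) (triMeshPoint δ dS) ≤ (7 * L : ℤ) * δ :=
      dist_triMeshPoint_le_of_triNorm_le hδ.le (hwD z hz).2.2
    push_cast at h1
    have h2 := hdS
    rw [dist_comm] at h2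
    linarith [dist_triangle (triMeshPoint δ z) (triMeshPoint δ dS) d']
  set Pb := triMeshPoint δ pb with hPb
  set Pd := triMeshPoint δ pd with hPd
  have hpbn : dist Pb b' ≤ 7 * L * δ + 7 / 10 * δ := hnearB pb (hW₁bs pb W₁b.end_mem_support)
  have hpdn : dist Pd d' ≤ 7 * L * δ + 7 / 10 * δ := hnearD pd (hW₁ds pd W₁d.end_mem_support)
  -- the exit points are on the right arcs
  have hfbseg : fb ∈ segment ℝ Pb (triMeshPoint δ pb') := by
    rw [hfb]; exact add_smul_sub_mem_segment htb0.le htb1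
  have hfdseg : fd ∈ segment ℝ Pd (triMeshPoint δ pd') := by
    rw [hfd]; exact add_smul_sub_mem_segment htd0.le htd1
  have hfbx : dist fb Pb ≤ δ := by
    have := dist_le_of_mem_subsegment_triMeshPoint hpbb hfbseg (right_mem_segment ℝ _ _)
    rwa [hδabs] at this
  have hfdx : dist fd Pd ≤ δ := by
    have := dist_le_of_mem_subsegment_triMeshPoint hpdd hfdseg (right_mem_segment ℝ _ _)
    rwa [hδabs] at this
  have hfbb : dist fb b' < r := by linarith [dist_triangle fb Pb b']
  have hfdd : dist fd d' < r := by linarith [dist_triangle fd Pd d']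
  have hfb1 : fb ∈ R.arc 1 := hrb fb hfbfr hfbb
  have hfd3 : fd ∈ R.arc 3 := hrd fd hfdfr hfdd
  have hfb_off : ∀ j, j ≠ 1 → fb ∉ R.arc j := fun j hj h => by
    have := hrb' j hj fb h; linarith
  have hfd_off : ∀ j, j ≠ 3 → fd ∉ R.arc j := fun j hj h => by
    have := hrd' j hj fd h; linarith
  obtain ⟨sb', hsb', hfbs⟩ := exists_mem_Ioo_of_mem_arc_one R hfb1 (hfb_off 0 (by decide))
    (hfb_off 2 (by decide))
  obtain ⟨td', htd', hfdt⟩ := exists_mem_Ioo_of_mem_arc_three R hfd3 (hfd_off 2 (by decide))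
    (hfd_off 0 (by decide))
  -- the `χ`-path from `pb` to `pd`
  set Q : triGraph.Walk pb pd := W₁b.reverse.append (Pth.append W₁d) with hQ
  have hQe : ∀ e ∈ Q.edges, e ∈ W₁b.edges ∨ e ∈ Pth.edges ∨ e ∈ W₁d.edges := by
    intro e he
    rw [hQ, SimpleGraph.Walk.edges_append, List.mem_append, SimpleGraph.Walk.edges_reverse,
      List.mem_reverse, SimpleGraph.Walk.edges_append, List.mem_append] at he
    rcases he with he | he | he
    · exact Or.inl he
    · exact Or.inr (Or.inl he)
    · exact Or.inr (Or.inr he)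
  have hQs : ∀ z ∈ Q.support, z ∈ χ := by
    intro z hz
    rw [hQ, SimpleGraph.Walk.mem_support_append_iff, SimpleGraph.Walk.support_reverse,
      List.mem_reverse, SimpleGraph.Walk.mem_support_append_iff] at hz
    rcases hz with hz | hz | hz
    · exact hχB z (hW₁bs z hz)
    · exact hPthχ z hz
    · exact hχD z (hW₁ds z hz)
  set Qp := Q.bypass with hQp
  have hQpe : ∀ e ∈ Qp.edges, e ∈ W₁b.edges ∨ e ∈ Pth.edges ∨ e ∈ W₁d.edges := fun e he =>
    hQe e (Q.edges_bypass_subset_edges he)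
  have hQps : ∀ z ∈ Qp.support, z ∈ χ := fun z hz => hQs z (Q.support_bypass_subset_support hz)
  have hQp_good : ∀ e ∈ Qp.edges, triEdgeSeg δ e ⊆ R.carrier := by
    intro e he
    rcases hQpe e he with h | h | h
    · exact hW₁bg e h
    · exact hPth_good e h
    · exact hW₁dg e h
  -- `Pb ≠ Pd`: they are near `b'` and `d'` respectively
  have hPbd : Pb ≠ Pd := by
    intro h
    have h1 : dist Pd b' ≤ 7 * L * δ + 7 / 10 * δ := h ▸ hpbn
    linarith [dist_triangle_left b' d' Pd]
  have hQpn : ¬ Qp.Nil := fun hn => hPbd (by rw [hPb, hPd, hn.eq])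
  -- the three arcs
  have hTarc : IsSimpleArc (triWalkTrace δ Qp) Pb Pd :=
    isSimpleArc_triWalkTrace hδ.ne' Q.bypass_isPath hQpn
  have hBarc : IsSimpleArc (segment ℝ Pb fb) fb Pb := by
    have := IsSimpleArc.subsegment (triMeshPoint_ne_of_adj hδ.ne' hpbb) htb0
    rw [← hfb] at this
    exact this.symm
  have hCarc : IsSimpleArc (segment ℝ Pd fd) Pd fd := by
    have := IsSimpleArc.subsegment (triMeshPoint_ne_of_adj hδ.ne' hpdd) htd0
    rw [← hfd] at this
    exact this
  -- gluing
  have h₁ : segment ℝ Pb fb ∩ triWalkTrace δ Qp ⊆ {Pb} :=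
    segment_inter_triWalkTrace_subset hδ hpbb htb0 htb1 hfb hfbΩ hQp_good
  have h₂ : (segment ℝ Pb fb ∪ triWalkTrace δ Qp) ∩ segment ℝ Pd fd ⊆ {Pd} := by
    rintro z ⟨hz | hz, hz'⟩
    · -- the two exit segments are far apart
      exfalso
      have h1 : dist z b' ≤ 7 * L * δ + 3 * δ := by
        have := dist_le_of_mem_subsegment_triMeshPoint hpbb hfbseg hz
        rw [hδabs] at this
        linarith [dist_triangle z Pb b']
      have h2 : dist z d' ≤ 7 * L * δ + 3 * δ := by
        have := dist_le_of_mem_subsegment_triMeshPoint hpdd hfdseg hz'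
        rw [hδabs] at this
        linarith [dist_triangle z Pd d']
      linarith [dist_triangle_left b' d' z]
    · have := segment_inter_triWalkTrace_subset hδ hpdd htd0 htd1 hfd hfdΩ (Q := Qp.reverse)
        (fun e he => hQp_good e (by rwa [SimpleGraph.Walk.edges_reverse, List.mem_reverse] at he))
      refine this ⟨hz', ?_⟩
      rwa [triWalkTrace_reverse]
  have harc : IsSimpleArc ((segment ℝ Pb fb ∪ triWalkTrace δ Qp) ∪ segment ℝ Pd fd) fb fd :=
    (hBarc.union hTarc h₁).union hCarc h₂
  set Λ : Set ℂ := (segment ℝ Pb fb ∪ triWalkTrace δ Qp) ∪ segment ℝ Pd fd with hΛ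
  -- classification of the points of `Λ`
  have hedge : ∀ z ∈ Λ, ∃ p q : Site 2, triGraph.Adj p q ∧ p ∈ χ ∧ q ∈ χ ∧
      z ∈ segment ℝ (triMeshPoint δ p) (triMeshPoint δ q) := by
    rintro z ((hz | hz) | hz)
    · refine ⟨pb, pb', hpbb, hχB pb (hW₁bs pb W₁b.end_mem_support), hχB pb' hpb'w, ?_⟩
      rw [hfb] at hz
      exact subsegment_subset htb0.le htb1 hz
    · obtain ⟨e, he, hze⟩ := mem_triWalkTrace_iff.1 hz
      revert he hze
      induction e using Sym2.ind with
      | h p q =>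
        intro he hze
        exact ⟨p, q, Qp.adj_of_mem_edges he, hQps p (Qp.fst_mem_support_of_mem_edges he),
          hQps q (Qp.snd_mem_support_of_mem_edges he), hze⟩
    · refine ⟨pd, pd', hpdd, hχD pd (hW₁ds pd W₁d.end_mem_support), hχD pd' hpd'w, ?_⟩
      rw [hfd] at hz
      exact subsegment_subset htd0.le htd1 hz
  have hwhere : ∀ z ∈ Λ, dist z b' ≤ 7 * L * δ + 3 * δ ∨ dist z d' ≤ 7 * L * δ + 3 * δ ∨
      ball z (w / 4) ⊆ R.carrier := by
    rintro z ((hz | hz) | hz)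
    · left
      have := dist_le_of_mem_subsegment_triMeshPoint hpbb hfbseg hz
      rw [hδabs] at this
      linarith [dist_triangle z Pb b']
    · obtain ⟨e, he, hze⟩ := mem_triWalkTrace_iff.1 hz
      rcases hQpe e he with h | h | h
      · left
        revert h hze
        induction e using Sym2.ind with
        | h p q =>
          intro hze h
          have hp := hnearB p (hW₁bs p (W₁b.fst_mem_support_of_mem_edges h))
          have hq := hnearB q (hW₁bs q (W₁b.snd_mem_support_of_mem_edges h))
          rw [triEdgeSeg_mk] at hze
          have hsub := (convex_closedBall b' (7 * L * δ + 7 / 10 * δ)).segment_subset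
            (mem_closedBall.2 hp) (mem_closedBall.2 hq) hze
          linarith [mem_closedBall.1 hsub]
      · exact Or.inr (Or.inr (hPth_deep e h z hze))
      · right; left
        revert h hze
        induction e using Sym2.ind with
        | h p q =>
          intro hze h
          have hp := hnearD p (hW₁ds p (W₁d.fst_mem_support_of_mem_edges h))
          have hq := hnearD q (hW₁ds q (W₁d.snd_mem_support_of_mem_edges h))
          rw [triEdgeSeg_mk] at hze
          have hsub := (convex_closedBall d' (7 * L * δ + 7 / 10 * δ)).segment_subset
            (mem_closedBall.2 hp) (mem_closedBall.2 hq) hze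
          linarith [mem_closedBall.1 hsub]
    · right; left
      have := dist_le_of_mem_subsegment_triMeshPoint hpdd hfdseg hz
      rw [hδabs] at this
      linarith [dist_triangle z Pd d']
  -- the cross-cut
  refine ⟨Λ, sb', td', hsb', htd', ⟨?_, ?_, ?_, ?_, ?_⟩, hedge, hwhere⟩
  · rw [← hfbs, ← hfdt]; exact harc
  · rw [← hfbs]; exact hfbfr
  · rw [← hfdt]; exact hfdfr
  · rw [← hfbs, ← hfdt]
    intro h
    have := hrb' 3 (by decide) fd hfd3
    rw [← h] at this
    linarith
  · rw [← hfbs, ← hfdt]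
    rintro z ⟨((hz | hz) | hz), hzne⟩
    · have hzf : z ≠ fb := fun h => hzne (Or.inl h)
      exact mem_of_mem_subsegment_of_ne htb0 hfb hbeforeb hz hzf
    · exact triWalkTrace_subset_of_edges hQp_good hz
    · have hzf : z ≠ fd := fun h => hzne (Or.inr h)
      exact mem_of_mem_subsegment_of_ne htd0 hfd hbefored hz hzf

/-! ### Exits of discrete boundary vertices and walks of the discrete domain -/

/-- **First frontier point along a boundary edge.** A discrete boundary vertex `x ∈ ∂Ω_δ` (on
`δ𝕋`) of an open set `Ω` has a `𝕋`-neighbour `y` and a point `f ∈ ∂Ω` on the closed mesh edge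
`[δx, δy]` such that the initial piece `[δx, f]` lies in `Ω̄`. [folklore] -/
theorem exists_frontier_exit_of_mem_triMeshBoundary {Ω : Set ℂ} (hΩ : IsOpen Ω) {δ : ℝ}
    {x : Site 2} (hx : x ∈ triMeshBoundary Ω δ) :
    ∃ (y : Site 2) (f : ℂ), triGraph.Adj x y ∧ f ∈ frontier Ω ∧
      f ∈ segment ℝ (triMeshPoint δ x) (triMeshPoint δ y) ∧
      segment ℝ (triMeshPoint δ x) f ⊆ closure Ω := by
  obtain ⟨y, hxy, hseg⟩ := exists_adj_not_segment_subset_of_mem_triMeshBoundary hΩ hx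
  have hxΩ : triMeshPoint δ x ∈ Ω := triMeshDomain_subset_triMeshVertices Ω δ hx.1
  obtain ⟨t, ht0, ht1, hfr, -, hbefore⟩ := exists_first_exit hΩ hxΩ hseg
  refine ⟨y, _, hxy, hfr, add_smul_sub_mem_segment ht0.le ht1, ?_⟩
  intro z hz
  obtain ⟨θ, hθ, rfl⟩ := exists_param_of_mem_subsegment hz
  rcases hθ.2.eq_or_lt with rfl | hθ1
  · rw [one_mul]
    exact frontier_subset_closure hfr
  · exact subset_closure (hbefore _ (mul_nonneg hθ.1 ht0.le) (by nlinarith))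

/-- A path of the discrete domain `Ω_δ` through vertices of `S` is a `𝕋`-walk with vertices in
`S` whose trace lies in `Ω̄`. [folklore] -/
theorem exists_triWalk_of_pathIn_domain {Ω : Set ℂ} {δ : ℝ} {S : Set (Site 2)} {x y : Site 2}
    (h : PathIn (triDiscreteDomainGraph Ω δ) (triMeshDomain Ω δ ∩ S) x y) :
    ∃ π : triGraph.Walk x y, (∀ z ∈ π.support, z ∈ S) ∧ triWalkTrace δ π ⊆ closure Ω := by
  obtain ⟨p, hp⟩ := h.exists_walk
  have hle : triDiscreteDomainGraph Ω δ ≤ triGraph := fun a b hab =>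
    triMeshGraph_le_triGraph Ω δ (triDiscreteDomainGraph_le_triMeshGraph Ω δ hab)
  refine ⟨p.mapLe hle, fun z hz => ?_, fun z hz => ?_⟩
  · rw [SimpleGraph.Walk.support_mapLe_eq_support] at hz
    exact (hp z hz).2
  · obtain ⟨e, he, hze⟩ := mem_triWalkTrace_iff.1 hz
    rw [SimpleGraph.Walk.edges_mapLe_eq_edges] at he
    revert he hze
    induction e using Sym2.ind with
    | h a b =>
      intro he hze
      have hadj : (triMeshGraph Ω δ).Adj a b :=
        triDiscreteDomainGraph_le_triMeshGraph Ω δ (p.adj_of_mem_edges he)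
      rw [triEdgeSeg_mk] at hze
      exact (triMeshGraph_adj_iff.1 hadj).2 hze

/-! ### Blocking: a closed cross-cut excludes open crossings of the complementary configuration -/

/-- **A cross-cut of `χ`-edges blocks open crossings of `χᶜ`** (the duality step of the RSW
upper bound on `𝕋`; Grimmett 2018, §5.7; Bollobás–Riordan 2006, Ch. 7 §2). Let `Λ` be a
cross-cut of the conformal rectangle `R` from `boundary s` to `boundary t` (`s < t < s + 1`)
every point of which lies on a closed mesh edge `[δp, δq]` with `p ∼ q` both in `χ`, and which
stays within `ρ` of `b'` or of `d'` or at depth `≥ dep` in `Ω`, where `2δ < dep` and the arcs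
`arc 0`, `arc 2` are at distance `≥ ρ + 3δ` from `b'` and `d'`. If moreover frontier points within
`2δ` of `arc 0` have parameters in `(t, s + 1)`, frontier points within `2δ` of `arc 2` have
parameters in `(s, t)`, and the two discrete arcs are disjoint, then the complementary
configuration `χᶜ` has no open path of `Ω_δ` from the discrete arc of `arc 0` to that of `arc 2`.
Requires Newman's cross-cut theorem (`Newman1939_crosscut_holds`).
[cite: Grimmett2018, §5.7 p. 176 and Exercise 5.6 p. 186] -/
theorem not_mem_triCrossing_compl_of_crosscut (R : RandomPlanarGeometry.ConformalRectangle)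
    {Λ : Set ℂ} {s t : ℝ} (hst : s < t) (hts : t < s + 1)
    (hΛ : R.IsCrosscut Λ (R.boundary s) (R.boundary t))
    {δ : ℝ} (hδ : 0 < δ) {χ : SiteConfig (Site 2)}
    (hedge : ∀ z ∈ Λ, ∃ p q : Site 2, triGraph.Adj p q ∧ p ∈ χ ∧ q ∈ χ ∧
      z ∈ segment ℝ (triMeshPoint δ p) (triMeshPoint δ q))
    {b' d' : ℂ} {ρ dep : ℝ}
    (hwhere : ∀ z ∈ Λ, dist z b' ≤ ρ ∨ dist z d' ≤ ρ ∨ ball z dep ⊆ R.carrier)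
    (hδdep : 2 * δ < dep)
    (hfar0 : ∀ a ∈ R.arc 0, ρ + 3 * δ ≤ dist a b' ∧ ρ + 3 * δ ≤ dist a d')
    (hfar2 : ∀ a ∈ R.arc 2, ρ + 3 * δ ≤ dist a b' ∧ ρ + 3 * δ ≤ dist a d')
    (H0 : ∀ f ∈ frontier R.carrier, infDist f (R.arc 0) ≤ 2 * δ →
      ∃ u ∈ Ioo t (s + 1), f = R.boundary u)
    (H2 : ∀ f ∈ frontier R.carrier, infDist f (R.arc 2) ≤ 2 * δ →
      ∃ u ∈ Ioo s t, f = R.boundary u)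
    (hdisj : triDiscreteArc R.carrier δ (R.arc 0) ∩ triDiscreteArc R.carrier δ (R.arc 2) = ∅) :
    χᶜ ∉ triCrossing R.carrier δ (R.arc 0) (R.arc 2) := by
  rintro ⟨x, hx, y, hy, hconn⟩
  have hP' : PathIn (triDiscreteDomainGraph R.carrier δ) (triMeshDomain R.carrier δ ∩ χᶜ) x y :=
    mem_siteConnIn_iff_pathIn.1 hconn
  obtain ⟨π, hπs, hπcl⟩ := exists_triWalk_of_pathIn_domain hP'
  have hxy : x ≠ y := by
    rintro rfl
    have : x ∈ triDiscreteArc R.carrier δ (R.arc 0) ∩ triDiscreteArc R.carrier δ (R.arc 2) :=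
      ⟨hx, hy⟩
    rw [hdisj] at this
    exact this
  have hπn : ¬ π.Nil := SimpleGraph.Walk.not_nil_of_ne hxy
  -- the two exits
  obtain ⟨x', fx, hxx', hfxfr, hfxseg, hfxcl⟩ :=
    exists_frontier_exit_of_mem_triMeshBoundary R.isOpen hx.1
  obtain ⟨y', fy, hyy', hfyfr, hfyseg, hfycl⟩ :=
    exists_frontier_exit_of_mem_triMeshBoundary R.isOpen hy.1
  have hδabs : |δ| = δ := abs_of_pos hδ
  have hsegx : ∀ z ∈ segment ℝ (triMeshPoint δ x) fx, dist z (triMeshPoint δ x) ≤ δ := fun z hz => by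
    have := dist_le_of_mem_subsegment_triMeshPoint hxx' hfxseg hz; rwa [hδabs] at this
  have hsegy : ∀ z ∈ segment ℝ (triMeshPoint δ y) fy, dist z (triMeshPoint δ y) ≤ δ := fun z hz => by
    have := dist_le_of_mem_subsegment_triMeshPoint hyy' hfyseg hz; rwa [hδabs] at this
  have hx0 : infDist (triMeshPoint δ x) (R.arc 0) ≤ δ := by
    have := infDist_le_of_mem_triDiscreteArc R.isOpen hx; rwa [hδabs] at this
  have hy2 : infDist (triMeshPoint δ y) (R.arc 2) ≤ δ := by
    have := infDist_le_of_mem_triDiscreteArc R.isOpen hy; rwa [hδabs] at this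
  have hsegx0 : ∀ z ∈ segment ℝ (triMeshPoint δ x) fx, infDist z (R.arc 0) ≤ 2 * δ := fun z hz => by
    linarith [infDist_le_infDist_add_dist (s := R.arc 0) (x := z) (y := triMeshPoint δ x), hsegx z hz]
  have hsegy2 : ∀ z ∈ segment ℝ (triMeshPoint δ y) fy, infDist z (R.arc 2) ≤ 2 * δ := fun z hz => by
    linarith [infDist_le_infDist_add_dist (s := R.arc 2) (x := z) (y := triMeshPoint δ y), hsegy z hz]
  obtain ⟨u', hu', hfxu⟩ := H0 fx hfxfr (hsegx0 fx (right_mem_segment ℝ _ _))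
  obtain ⟨u, hu, hfyu⟩ := H2 fy hfyfr (hsegy2 fy (right_mem_segment ℝ _ _))
  -- the connected set `P ⊆ Ω̄` joining the two arcs cut off by `Λ`
  set P : Set ℂ := (triWalkTrace δ π ∪ segment ℝ (triMeshPoint δ x) fx) ∪
    segment ℝ (triMeshPoint δ y) fy with hP
  have hxM : triMeshPoint δ x ∈ triWalkTrace δ π := triMeshPoint_mem_triWalkTrace hπn π.start_mem_support
  have hyM : triMeshPoint δ y ∈ triWalkTrace δ π := triMeshPoint_mem_triWalkTrace hπn π.end_mem_support
  have hPpre : IsPreconnected P :=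
    ((isPreconnected_triWalkTrace δ π).union (triMeshPoint δ x) hxM (left_mem_segment ℝ _ _)
      (convex_segment _ _).isPreconnected).union (triMeshPoint δ y) (Or.inl hyM)
      (left_mem_segment ℝ _ _) (convex_segment _ _).isPreconnected
  have hPcl : P ⊆ closure R.carrier := by
    rintro z ((hz | hz) | hz)
    · exact hπcl hz
    · exact hfxcl hz
    · exact hfycl hz
  have hfyP : R.boundary u ∈ P := by
    rw [← hfyu]; exact Or.inr (right_mem_segment ℝ _ _)
  have hfxP : R.boundary u' ∈ P := by
    rw [← hfxu]; exact Or.inl (Or.inr (right_mem_segment ℝ _ _))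
  obtain ⟨z, hzP, hzΛ⟩ := R.toJordanDomain.inter_nonempty_of_crosscut Newman1939_crosscut_holds
    hst hts hΛ hPpre hPcl hu hfyP hu' hfxP
  -- frontier points are not in `Ω`
  have hnotΩ : ∀ f ∈ frontier R.carrier, f ∉ R.carrier := fun f hf h => by
    rw [R.isOpen.frontier_eq] at hf
    exact hf.2 h
  -- shallow points far from `b'`, `d'` cannot be on `Λ`
  have hshallow : ∀ (A : Set ℂ) (f q : ℂ), A.Nonempty → f ∈ frontier R.carrier →
      (∀ a ∈ A, ρ + 3 * δ ≤ dist a b' ∧ ρ + 3 * δ ≤ dist a d') →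
      infDist z A ≤ 2 * δ → dist z q ≤ δ → dist f q ≤ δ → False := by
    intro A f q hA hf hfarA hzA hzq hfq
    obtain ⟨a, ha, hza⟩ := (infDist_lt_iff hA).1 (show infDist z A < 3 * δ by linarith)
    rcases hwhere z hzΛ with h | h | h
    · linarith [(hfarA a ha).1, dist_triangle a z b', dist_comm a z]
    · linarith [(hfarA a ha).2, dist_triangle a z d', dist_comm a z]
    · refine hnotΩ f hf (h (mem_ball.2 ?_))
      linarith [dist_triangle f q z, dist_comm q z]
  rcases hzP with ((hz | hz) | hz)
  · -- on the open path: a mesh edge of `χᶜ`-sites would meet a mesh edge of `χ`-sites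
    obtain ⟨p, q, hpq, hp, hq, hzpq⟩ := hedge z hzΛ
    exact Set.disjoint_left.1 (disjoint_segment_triWalkTrace hδ.ne' (χ := χᶜ) hπs hpq
      (fun h => h hp) (fun h => h hq)) hzpq hz
  · exact hshallow (R.arc 0) fx (triMeshPoint δ x) ⟨_, R.pt_mem_arc_self 0⟩ hfxfr hfar0
      (hsegx0 z hz) (hsegx z hz) (hsegx fx (right_mem_segment ℝ _ _))
  · exact hshallow (R.arc 2) fy (triMeshPoint δ y) ⟨_, R.pt_mem_arc_self 2⟩ hfyfr hfar2
      (hsegy2 z hz) (hsegy z hz) (hsegy fy (right_mem_segment ℝ _ _))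

/-! ### The upper bound -/

/-- **RSW upper bound for triangular conformal-rectangle crossings holds** (discharge of the
named fact `triCrossingProb_upperBound`, the "bounded away from `1`" half of Grimmett 2018,
§5.7 p. 176 / Exercise 5.6 for H21's discretisation `triCrossing`). For every conformal
rectangle `R` there are `c₂ < 1` and `δ₀ > 0` with `P_{1/2}[C_δ(Ω; arc 0, arc 2)] ≤ c₂` for all
`0 < δ < δ₀`. Proof: with probability `≥ c' > 0` (RSW `tri_rsw_half_holds`, annulus circuits,
Harris–FKG: `le_real_triChainEvents`; colour symmetry at `p = 1/2`:
`triSitePercolation_half_real_preimage_compl`) the *complement* of the configuration contains the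
chain of circuits and long crossings of `exists_closed_crosscut` from `arc 1°` to `arc 3°`; the
resulting cross-cut of closed mesh edges blocks every open crossing
(`not_mem_triCrossing_compl_of_crosscut`, Newman's cross-cut theorem). No hypothesis on the
boundary curve is needed for this half. [cite: Grimmett2018, §5.7 p. 176 and Exercise 5.6 p. 186] -/
theorem triCrossingProb_upperBound_holds : triCrossingProb_upperBound := by
  intro R
  classical
  obtain ⟨b', d', r, w, N, c, hr, hw, hwr, hb', hd', hrb, hrb', hrd, hrd', hbd, hc0, hcN, hstep,
    hball⟩ := exists_chainData R (i := 1) (i' := 3) (by decide)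
  -- probability inputs
  obtain ⟨c₀, hc₀, -, hc₀l⟩ := exists_pos_le_real_triCircuitAt
  obtain ⟨cX, hcX, hcross⟩ := tri_rsw_half_holds 18 (by norm_num)
  have hcXl : ∀ l : ℕ, 1 ≤ l → cX ≤ triLRCrossingProb half (18 * l) l := by
    intro l hl
    have hfloor : ⌊(18 : ℝ) * l⌋₊ = 18 * l := by
      rw [show (18 : ℝ) * l = ((18 * l : ℕ) : ℝ) by push_cast; ring, Nat.floor_natCast]
    have := (hcross l (by rw [hfloor]; omega)).1
    rwa [hfloor] at this
  obtain ⟨h0, h01, h12, h23, h3⟩ := mark_chain R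
  -- continuity modulus of the boundary loop at scale `r / 2`
  obtain ⟨η, hη, -, hηc⟩ := exists_forall_dist_boundary_lt R (half_pos hr)
  -- the far boundary pieces keep a positive distance from `arc 0`, `arc 2`
  obtain ⟨ε₀, hε₀, hfar₀⟩ := exists_pos_forall_lt_infDist
    (isCompact_Icc.image R.continuous_boundary) (R.isClosed_arc 0)
    (disjoint_image_Icc_arc_zero R hη) ⟨_, R.pt_mem_arc_self 0⟩
  obtain ⟨ε₂, hε₂, hfar₂⟩ := exists_pos_forall_lt_infDist
    (isCompact_Icc.image R.continuous_boundary) (R.isClosed_arc 2)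
    (disjoint_image_Icc_arc_two R hη) ⟨_, R.pt_mem_arc_self 2⟩
  -- disjointness of the discrete arcs
  obtain ⟨ε', hε', hε'd⟩ := R.exists_pos_forall_lt_dist_arc
  -- exterior walks near `b'` and `d'`
  obtain ⟨δb, hδb, hextb⟩ :=
    exists_exterior_triWalk R.toJordanDomain hb' (ρ₁ := r / 100) (by positivity) r
  obtain ⟨δd, hδd, hextd⟩ :=
    exists_exterior_triWalk R.toJordanDomain hd' (ρ₁ := r / 100) (by positivity) r
  set c' : ℝ := c₀ ^ (N + 1) * cX ^ N * c₀ * c₀ with hc'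
  have hc'pos : 0 < c' := by positivity
  refine ⟨1 - c', min (min (w / 1000) (min δb δd)) (min (min (ε₀ / 3) (ε₂ / 3)) (ε' / 2)),
    by linarith, by positivity, fun δ hδ hδlt => ?_⟩
  have hδw : δ ≤ w / 1000 := (hδlt.trans_le ((min_le_left _ _).trans (min_le_left _ _))).le
  have hδb' : δ < δb :=
    hδlt.trans_le ((min_le_left _ _).trans ((min_le_right _ _).trans (min_le_left _ _)))
  have hδd' : δ < δd :=
    hδlt.trans_le ((min_le_left _ _).trans ((min_le_right _ _).trans (min_le_right _ _)))
  have hδε₀ : δ < ε₀ / 3 :=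
    hδlt.trans_le ((min_le_right _ _).trans ((min_le_left _ _).trans (min_le_left _ _)))
  have hδε₂ : δ < ε₂ / 3 :=
    hδlt.trans_le ((min_le_right _ _).trans ((min_le_left _ _).trans (min_le_right _ _)))
  have hδε' : δ < ε' / 2 := hδlt.trans_le ((min_le_right _ _).trans (min_le_right _ _))
  -- the scales
  obtain ⟨hm1, hmw, hmw'⟩ := floor_scale_bounds' hδ (s := w) (by linarith)
  obtain ⟨hL1, hLr, hLr'⟩ := floor_scale_bounds' hδ (s := r) (by linarith)
  set m : ℕ := ⌊w / (20 * δ)⌋₊ with hm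
  set L : ℕ := ⌊r / (20 * δ)⌋₊ with hL
  -- roundings
  have hround : ∀ z : ℂ, ∃ x : Site 2, dist z (triMeshPoint δ x) ≤ 7 / 10 * δ :=
    fun z => exists_dist_triMeshPoint_le hδ z
  choose rd hrdist using hround
  set v : ℕ → Site 2 := fun k => rd (c k) with hv
  -- the chain events for the conjugate data and their probability
  set A : Set (SiteConfig (Site 2)) :=
    (((⋂ k ∈ Finset.range (N + 1), triCircuitAt true (v k) m) ∩
      ⋂ k ∈ Finset.range N, SiteConfig.relabel (triShiftIso (-triChainCorner m (v k))).toEquiv ⁻¹'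
        triTBCrossing m (18 * m)) ∩
      triCircuitAt true (rd b') L) ∩ triCircuitAt true (rd d') L with hA
  set P := triSitePercolation half with hP
  have hAmeas : MeasurableSet A :=
    (((Finset.measurableSet_biInter _ fun k _ => measurableSet_triCircuitAt true (v k) m).inter
      (Finset.measurableSet_biInter _ fun k _ =>
        measurableSet_shift_triTBCrossing (triChainCorner m (v k)) m (18 * m))).inter
      (measurableSet_triCircuitAt true (rd b') L)).inter (measurableSet_triCircuitAt true (rd d') L)
  have hPA : c' ≤ P.real A :=
    le_real_triChainEvents hc₀ hcX (fun v k hk => hc₀l true v k hk) hcXl hm1 hL1 N v (rd b') (rd d')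
  have hPA' : c' ≤ P.real (compl ⁻¹' A) := by
    rw [hP, triSitePercolation_half_real_preimage_compl]; exact hPA
  -- exterior walks at this mesh
  obtain ⟨xb, yb, qb, hxb, hyb, hqb⟩ := hextb δ hδ hδb'
  obtain ⟨xd, yd, qd, hxd, hyd, hqd⟩ := hextd δ hδ hδd'
  -- on the pulled-back event there is no open crossing
  have hblock : ∀ ω : SiteConfig (Site 2), ω ∈ compl ⁻¹' A →
      ω ∉ triCrossing R.carrier δ (R.arc 0) (R.arc 2) := by
    intro ω hω
    obtain ⟨⟨⟨h₁, h₂⟩, h₃⟩, h₄⟩ := (show ωᶜ ∈ A from hω)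
    obtain ⟨Λ, s, t, hs, ht, hΛ, hedge, hwhere⟩ := exists_closed_crosscut R hwr hrb hrb' hrd hrd'
      hbd hc0 hcN hstep hball hδ hδw hm1 hmw hmw' hLr hLr' (fun k _ => hrdist (c k)) (hrdist b') (hrdist d')
      qb hxb hyb hqb qd hxd hyd hqd
      (fun k hk => mem_iInter₂.1 h₁ k (Finset.mem_range.2 (Nat.lt_succ_of_le hk)))
      (fun k hk => mem_iInter₂.1 h₂ k (Finset.mem_range.2 hk)) h₃ h₄
    set ρ : ℝ := 7 * L * δ + 3 * δ with hρdef
    have hLδ : 7 * (L : ℝ) * δ ≤ 7 * r / 20 := by nlinarith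
    have hρr : ρ < r / 2 := by rw [hρdef]; linarith
    -- the end-points of `Λ` are near `b'`, `d'`
    have hnotΩ : ∀ f ∈ frontier R.carrier, f ∉ R.carrier := fun f hf h => by
      rw [R.isOpen.frontier_eq] at hf
      exact hf.2 h
    have hsb : dist (R.boundary s) b' ≤ ρ := by
      have hs1 : R.boundary s ∈ R.arc 1 := ⟨s, ⟨hs.1.le, by rw [R.nextMark_one]; exact hs.2.le⟩, rfl⟩
      rcases hwhere _ hΛ.1.left_mem with h | h | h
      · exact h
      · have := hrd' 1 (by decide) _ hs1; linarith
      · exact absurd (h (mem_ball_self (by linarith))) (hnotΩ _ (R.boundary_mem_frontier s))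
    have htd : dist (R.boundary t) d' ≤ ρ := by
      have ht3 : R.boundary t ∈ R.arc 3 :=
        ⟨t, ⟨ht.1.le, by rw [R.nextMark_three]; exact ht.2.le⟩, rfl⟩
      rcases hwhere _ hΛ.1.right_mem with h | h | h
      · have := hrb' 3 (by decide) _ ht3; linarith
      · exact h
      · exact absurd (h (mem_ball_self (by linarith))) (hnotΩ _ (R.boundary_mem_frontier t))
    obtain ⟨hs', hs'', ht', ht''⟩ :=
      crosscut_param_bounds R hrb' hrd' hρr hηc hs ht hsb htd
    have key := not_mem_triCrossing_compl_of_crosscut R (by linarith [hs.2, ht.1])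
      (by linarith [hs.1, ht.2]) hΛ hδ hedge hwhere (dep := w / 4) (by linarith) ?_ ?_ ?_ ?_ ?_
    · rwa [compl_compl] at key
    · intro a ha
      exact ⟨by rw [hρdef]; linarith [hrb' 0 (by decide) a ha],
        by rw [hρdef]; linarith [hrd' 0 (by decide) a ha]⟩
    · intro a ha
      exact ⟨by rw [hρdef]; linarith [hrb' 2 (by decide) a ha],
        by rw [hρdef]; linarith [hrd' 2 (by decide) a ha]⟩
    · intro f hf hfd
      exact exists_Ioo_of_infDist_arc_zero R hfar₀ hs' ht'' hf (by linarith)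
    · intro f hf hfd
      exact exists_Ioo_of_infDist_arc_two R hfar₂ hs' hs'' ht' hf (by linarith)
    · refine triDiscreteArc_inter_eq_empty_of_lt R hε'd ?_
      rw [abs_of_pos hδ]; linarith
  -- probability bookkeeping
  have hdisj : Disjoint (triCrossing R.carrier δ (R.arc 0) (R.arc 2)) (compl ⁻¹' A) :=
    disjoint_left.2 fun ω hω hA' => hblock ω hA' hω
  have hBmeas : MeasurableSet (compl ⁻¹' A : Set (SiteConfig (Site 2))) :=
    (SiteConfig.complEquiv (Site 2)).measurable hAmeas
  have hunion := measureReal_union hdisj hBmeas (μ := P)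
  have hle1 : P.real (triCrossing R.carrier δ (R.arc 0) (R.arc 2) ∪ compl ⁻¹' A) ≤ 1 :=
    measureReal_le_one
  change P.real (triCrossing R.carrier δ (R.arc 0) (R.arc 2)) ≤ 1 - c'
  linarith

/-- **Every subsequential limit of the triangular crossing probability is `< 1`**, for every
conformal rectangle (the upper half of `triCrossingProb_clusterPt_mem_Ioo`, unconditional).
[cite: Grimmett2018, §5.7 p. 176] -/
theorem lt_one_of_mapClusterPt_triCrossingProb (R : RandomPlanarGeometry.ConformalRectangle)
    {a : ℝ} (ha : MapClusterPt a (𝓝[>] 0) fun δ =>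
      triCrossingProb R.carrier δ (R.arc 0) (R.arc 2) half) :
    a < 1 := by
  obtain ⟨c₂, δ₀, hc₂, hδ₀, h⟩ := triCrossingProb_upperBound_holds R
  have hev : ∀ᶠ δ in 𝓝[>] (0 : ℝ),
      triCrossingProb R.carrier δ (R.arc 0) (R.arc 2) half ∈ Iic c₂ := by
    filter_upwards [Ioo_mem_nhdsGT hδ₀] with δ hδ
    exact h δ hδ.1 hδ.2
  exact (isClosed_Iic.mem_of_mapClusterPt ha hev).trans_lt hc₂

end

end Literature.Probability.Percolation
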